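import Mathlib
import HarnessLib

/-!
# Raising and lowering operators on the Boolean lattice: the harmonic (Johnson-scheme)
# decomposition of low-degree functions on slices, by the ladder calculus

Source followed: T. Lee, A. Prakash, R. de Wolf, H. Yuen, *On the sum-of-squares degree of symmetric
quadratic functions*, CCC 2016, Appendix B "Blekherman's theorem" [LeePrakashDewolfYuen2016]
(held: `paper:arxiv-1601.02311`, text chunks 18–22), which develops, for the proof of Blekherman's
symmetrisation theorem (their Thm. B.11) and of Grigoriev's knapsack lower bound (their App. C), the
following calculus on multilinear polynomials `p = Σ_S p_S x^S` on the cube `{0,1}^n`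
(coefficient vectors `Finset (Fin n) → ℝ`):

* the lowering operator `W_t` ("acts by summing over the partial derivatives", matrix
  `(W_t)_{S,T} = 1` iff `S ⊂ T`, `|T| = |S| + 1`; here `down`) and its transpose, the raising operator
  `W_tᵀ x^S = Σ_{i ∉ S} x^{S ∪ {i}} = x^S (|x| − t + 1)` on the cube (App. B eq. (B.2); here `up`, and
  `zeta_up_of_isHomog` for the displayed identity), adjoint for the coefficient inner product
  `⟨p|q⟩ = Σ_S p_S q_S` (here `ip`; `ip_up_left`);
* `Ker W_t` = the HARMONIC vectors of degree `t` (`IsHarmonic`), the decomposition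
  `L_t = Ker W_t ⊕ Im W_tᵀ` iterated to `p = p_t + (|x|−t+1) p_{t−1} + ⋯` (their Thm. B.5 / Cor. B.6;
  here `exists_ladder_decomposition`, `exists_harmonic_decomposition`);
* the slice formulas: for `p, q ∈ Ker W_t`, `Sym(pq)(x) = ⟨p|q⟩ (n−2t)!/n! · Π_{i<t} (|x|−i)(n−|x|−i)`
  (their Lemma B.8), i.e. `Σ_{|S| = s} p(1_S) q(1_S) = C(n−2t, s−t) ⟨p|q⟩` (here
  `slice_sum_zeta_mul_zeta_same`), and `Sym(pq) = 0` for harmonic `p, q` of different degrees (their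
  Lemma B.10; here `slice_sum_zeta_mul_zeta_cross`); together, "Parseval on a slice" for a harmonic
  decomposition (`slice_sum_zeta_sq`), which is the content of their Thm. B.11 read slice by slice.

DEVIATION FROM THE PRINTED PROOF (a shorter road, same statements). LPdWY prove Lemmas B.8/B.10 from
an explicit basis of `Ker W_t` indexed by standard Young tableaux (their Thm. B.4: straightening + hook
length formula) and obtain `L_t = Ker W_t ⊕ Im W_tᵀ` from the Johnson-graph spectrum (their Thm. B.1,
Lemma B.2). We replace both by the elementary LADDER CALCULUS of the Johnson scheme, which needs no basis
and no dimension count: the pointwise commutation relation `W Wᵀ − Wᵀ W = (n − 2|T|)·id`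
(`down_up_sub_up_down`, a double count), whence for harmonic `p` of degree `t` the eigen-relation
`W (Wᵀ)^{m+1} p = (m+1)(n−2t−m) (Wᵀ)^m p` (`down_iterate_up_of_isHarmonic`), the ladder norms
`⟨(Wᵀ)^m p, (Wᵀ)^m q⟩ = m! Π_{i<m}(n−2t−i) ⟨p, q⟩` (`ip_iterate_up_of_isHarmonic`), orthogonality of
ladders of different lengths by adjointness (`ip_iterate_up_cross`), and the identity
`((Wᵀ)^m p)_S = m! Σ_{T ⊆ S, |T| = t} p_T` (`iterate_up_apply_of_isHomog`; this is Grigoriev's (2.1)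
[Grigoriev2001, §2 (PDF p. 9)]). The decomposition `L_t = Ker W_t ⊕ Wᵀ L_{t−1}` is obtained for
`2t ≤ n + 1` by inverting `W Wᵀ` on the ladder components of `W v` (the eigenvalues above are then
nonzero) instead of by orthogonal projection. Everything is PROVED; no facts, standard axioms.

Consumer: the discharge of Grigoriev's Lemma 1.4 (`Literature.Computability.Complexity.
Grigoriev2001_knapsackFormNonneg_holds` in `Computability/Complexity/KnapsackSosDegree.lean`), which is
LPdWY's App. C argument. NOT here: Blekherman's theorem in its univariate-sos phrasing (Thm. B.11 as
printed), the Johnson-graph spectrum (Thm. B.1), the tableau basis (Thm. B.4), symmetrisation `Sym`.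

## References
* [LeePrakashDewolfYuen2016] T. Lee, A. Prakash, R. de Wolf, H. Yuen, CCC 2016 (LIPIcs 50, 17),
  arXiv:1601.02311, App. B.
* [Grigoriev2001] D. Grigoriev, *Complexity of Positivstellensatz proofs for the knapsack*, comput.
  complexity 10 (2001) 139–154, §2.
* [Delsarte1973] P. Delsarte, *An algebraic approach to the association schemes of coding theory*
  (the Johnson scheme), for context only.
-/

noncomputable section

open Finset
open scoped BigOperators

namespace Literature.Combinatorics.AssociationSchemes

namespace JohnsonHarmonics

variable {n : ℕ}

/-- The **raising operator** `W_tᵀ` on coefficient vectors indexed by subsets: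
`(up v) S = Σ_{i ∈ S} v (S \ {i})`.
[cite: LeePrakashDewolfYuen2016, App. B §B.1 (operators W_t, eq. (B.1)–(B.2); arXiv text chunk 19)] -/
def up : (Finset (Fin n) → ℝ) →ₗ[ℝ] (Finset (Fin n) → ℝ) where
  toFun v S := ∑ i ∈ S, v (S.erase i)
  map_add' u v := by ext S; simp [sum_add_distrib]
  map_smul' c v := by ext S; simp [mul_sum]

/-- The **lowering operator** `W_t`: `(down v) T = Σ_{i ∉ T} v (T ∪ {i})`.
[cite: LeePrakashDewolfYuen2016, App. B §B.1 (operators W_t, eq. (B.1)–(B.2); arXiv text chunk 19)] -/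
def down : (Finset (Fin n) → ℝ) →ₗ[ℝ] (Finset (Fin n) → ℝ) where
  toFun v T := ∑ i ∈ Tᶜ, v (insert i T)
  map_add' u v := by ext S; simp [sum_add_distrib]
  map_smul' c v := by ext S; simp [mul_sum]

/-- **Evaluation on the cube** (zeta transform): the multilinear polynomial with coefficient
vector `v` evaluated at the indicator vector of `S` is `(zeta v) S = Σ_{T ⊆ S} v T`.
[cite: LeePrakashDewolfYuen2016, App. B §B.1 (operators W_t, eq. (B.1)–(B.2); arXiv text chunk 19)] -/
def zeta : (Finset (Fin n) → ℝ) →ₗ[ℝ] (Finset (Fin n) → ℝ) where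
  toFun v S := ∑ T ∈ S.powerset, v T
  map_add' u v := by ext S; simp [sum_add_distrib]
  map_smul' c v := by ext S; simp [mul_sum]

/-- The coefficient inner product `⟪u, v⟫ = Σ_S u_S v_S`.
[cite: LeePrakashDewolfYuen2016, App. B §B.3 (inner product ⟨p|q⟩ := Σ_S p_S q_S; arXiv text chunk 20)] -/
def ip (u v : Finset (Fin n) → ℝ) : ℝ := ∑ S, u S * v S

/-- Unfolding of `up`. [cite: LeePrakashDewolfYuen2016, App. B §B.1 (operators W_t, eq. (B.1)–(B.2); arXiv text chunk 19)] -/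
@[simp] theorem up_apply (v : Finset (Fin n) → ℝ) (S : Finset (Fin n)) :
    up v S = ∑ i ∈ S, v (S.erase i) := rfl

/-- Unfolding of `down`. [cite: LeePrakashDewolfYuen2016, App. B §B.1 (operators W_t, eq. (B.1)–(B.2); arXiv text chunk 19)] -/
@[simp] theorem down_apply (v : Finset (Fin n) → ℝ) (T : Finset (Fin n)) :
    down v T = ∑ i ∈ Tᶜ, v (insert i T) := rfl

/-- Unfolding of `zeta`. [cite: LeePrakashDewolfYuen2016, App. B §B.1 (operators W_t, eq. (B.1)–(B.2); arXiv text chunk 19)] -/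
@[simp] theorem zeta_apply (v : Finset (Fin n) → ℝ) (S : Finset (Fin n)) :
    zeta v S = ∑ T ∈ S.powerset, v T := rfl

/-- Symmetry of the coefficient inner product. [cite: LeePrakashDewolfYuen2016, App. B §B.3 (inner product ⟨p|q⟩ := Σ_S p_S q_S; arXiv text chunk 20)] -/
theorem ip_comm (u v : Finset (Fin n) → ℝ) : ip u v = ip v u := by
  unfold ip; exact sum_congr rfl fun S _ => mul_comm _ _

/-- Additivity of the coefficient inner product (left). [cite: LeePrakashDewolfYuen2016, App. B §B.3 (inner product ⟨p|q⟩ := Σ_S p_S q_S; arXiv text chunk 20)] -/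
theorem ip_add_left (u u' v : Finset (Fin n) → ℝ) : ip (u + u') v = ip u v + ip u' v := by
  simp [ip, add_mul, sum_add_distrib]

/-- Homogeneity of the coefficient inner product (left). [cite: LeePrakashDewolfYuen2016, App. B §B.3 (inner product ⟨p|q⟩ := Σ_S p_S q_S; arXiv text chunk 20)] -/
theorem ip_smul_left (c : ℝ) (u v : Finset (Fin n) → ℝ) : ip (c • u) v = c * ip u v := by
  simp [ip, mul_sum, mul_assoc]

/-- `⟪u, u⟫ ≥ 0`. [cite: LeePrakashDewolfYuen2016, App. B §B.3 (inner product ⟨p|q⟩ := Σ_S p_S q_S; arXiv text chunk 20)] -/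
theorem ip_self_nonneg (u : Finset (Fin n) → ℝ) : 0 ≤ ip u u :=
  sum_nonneg fun _ _ => mul_self_nonneg _

/-- Re-indexing a sum over the sets containing `i` by the sets not containing `i`.
[cite: LeePrakashDewolfYuen2016, App. B §B.1 (operators W_t, eq. (B.1)–(B.2); arXiv text chunk 19)] -/
theorem sum_filter_mem_eq_sum_filter_not_mem (i : Fin n) (F : Finset (Fin n) → ℝ) :
    ∑ S ∈ univ.filter (fun S : Finset (Fin n) => i ∈ S), F S =
      ∑ T ∈ univ.filter (fun T : Finset (Fin n) => i ∉ T), F (insert i T) := by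
  refine (sum_nbij' (fun T => insert i T) (fun S => S.erase i) ?_ ?_ ?_ ?_ ?_).symm
  · intro T hT; simp at hT ⊢
  · intro S hS; simp at hS ⊢
  · intro T hT; simp at hT; exact erase_insert hT
  · intro S hS; simp at hS; exact insert_erase hS
  · intro T hT; rfl

/-- **Adjointness**: `⟪up v, u⟫ = ⟪v, down u⟫` (`W_tᵀ` is the transpose of `W_t`).
[cite: LeePrakashDewolfYuen2016, App. B §B.1 (operators W_t, eq. (B.1)–(B.2); arXiv text chunk 19)] -/
theorem ip_up_left (v u : Finset (Fin n) → ℝ) : ip (up v) u = ip v (down u) := by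
  unfold ip
  simp only [up_apply, down_apply, sum_mul, mul_sum]
  -- LHS: Σ_S Σ_{i ∈ S} v (S.erase i) * u S ; RHS: Σ_T Σ_{i ∈ Tᶜ} v T * u (insert i T)
  have hL : ∑ S : Finset (Fin n), ∑ i ∈ S, v (S.erase i) * u S =
      ∑ i : Fin n, ∑ S ∈ univ.filter (fun S : Finset (Fin n) => i ∈ S), v (S.erase i) * u S := by
    rw [sum_comm' (t' := univ) (s' := fun i => univ.filter (fun S : Finset (Fin n) => i ∈ S))]
    intro i S; simp
  have hR : ∑ T : Finset (Fin n), ∑ i ∈ Tᶜ, v T * u (insert i T) =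
      ∑ i : Fin n, ∑ T ∈ univ.filter (fun T : Finset (Fin n) => i ∉ T), v T * u (insert i T) := by
    rw [sum_comm' (t' := univ) (s' := fun i => univ.filter (fun T : Finset (Fin n) => i ∉ T))]
    intro i T; simp
  rw [hL, hR]
  refine sum_congr rfl fun i _ => ?_
  rw [sum_filter_mem_eq_sum_filter_not_mem i]
  refine sum_congr rfl fun T hT => ?_
  simp only [mem_filter, mem_univ, true_and] at hT
  rw [erase_insert hT]

/-- **The commutation relation** `W W ᵀ − Wᵀ W = (n − 2|T|)·id`, pointwise:
`down (up v) T − up (down v) T = (n − 2|T|) v T`.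
[cite: LeePrakashDewolfYuen2016, App. B Thm. B.1 / Lemma B.8 (Johnson-scheme spectrum; arXiv text chunks 19, 21)] -/
theorem down_up_sub_up_down (v : Finset (Fin n) → ℝ) (T : Finset (Fin n)) :
    down (up v) T - up (down v) T = ((n : ℝ) - 2 * T.card) * v T := by
  simp only [down_apply, up_apply]
  have h1 : ∀ i ∈ Tᶜ, ∑ j ∈ insert i T, v ((insert i T).erase j) =
      v T + ∑ j ∈ T, v (insert i (T.erase j)) := by
    intro i hi
    rw [mem_compl] at hi
    rw [sum_insert hi, erase_insert hi]
    congr 1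
    refine sum_congr rfl fun j hj => ?_
    rw [erase_insert_of_ne (fun h => hi (by rw [h]; exact hj))]
  have h2 : ∀ j ∈ T, ∑ i ∈ (T.erase j)ᶜ, v (insert i (T.erase j)) =
      v T + ∑ i ∈ Tᶜ, v (insert i (T.erase j)) := by
    intro j hj
    have : (T.erase j)ᶜ = insert j Tᶜ := by
      ext x; simp only [mem_compl, mem_erase, mem_insert, not_and]; tauto
    rw [this, sum_insert (by simpa using hj), insert_erase hj]
  rw [sum_congr rfl h1, sum_congr rfl h2, sum_add_distrib, sum_add_distrib, sum_const, sum_const,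
    sum_comm, nsmul_eq_mul, nsmul_eq_mul, card_compl, Fintype.card_fin, Nat.cast_sub (card_finset_fin_le T)]
  ring


/-- Homogeneity of the coefficient inner product (right). [cite: LeePrakashDewolfYuen2016, App. B §B.3 (inner product ⟨p|q⟩ := Σ_S p_S q_S; arXiv text chunk 20)] -/
theorem ip_smul_right (c : ℝ) (u v : Finset (Fin n) → ℝ) : ip u (c • v) = c * ip u v := by
  rw [ip_comm, ip_smul_left, ip_comm]

/-- `⟪u, 0⟫ = 0`. [cite: LeePrakashDewolfYuen2016, App. B §B.3 (inner product ⟨p|q⟩ := Σ_S p_S q_S; arXiv text chunk 20)] -/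
theorem ip_zero_right (u : Finset (Fin n) → ℝ) : ip u 0 = 0 := by simp [ip]

/-- `⟪0, v⟫ = 0`. [cite: LeePrakashDewolfYuen2016, App. B §B.3 (inner product ⟨p|q⟩ := Σ_S p_S q_S; arXiv text chunk 20)] -/
theorem ip_zero_left (v : Finset (Fin n) → ℝ) : ip 0 v = 0 := by simp [ip]

/-- Additivity of the coefficient inner product (right). [cite: LeePrakashDewolfYuen2016, App. B §B.3 (inner product ⟨p|q⟩ := Σ_S p_S q_S; arXiv text chunk 20)] -/
theorem ip_add_right (u v v' : Finset (Fin n) → ℝ) : ip u (v + v') = ip u v + ip u v' := by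
  rw [ip_comm, ip_add_left, ip_comm v, ip_comm v']

/-- Finite additivity of the coefficient inner product (left). [cite: LeePrakashDewolfYuen2016, App. B §B.3 (inner product ⟨p|q⟩ := Σ_S p_S q_S; arXiv text chunk 20)] -/
theorem ip_sum_left {ι : Type*} (s : Finset ι) (u : ι → Finset (Fin n) → ℝ) (v : Finset (Fin n) → ℝ) :
    ip (∑ i ∈ s, u i) v = ∑ i ∈ s, ip (u i) v := by
  classical
  induction s using Finset.induction_on with
  | empty => simp [ip_zero_left]
  | insert a s ha ih => rw [sum_insert ha, sum_insert ha, ip_add_left, ih]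

/-- Finite additivity of the coefficient inner product (right). [cite: LeePrakashDewolfYuen2016, App. B §B.3 (inner product ⟨p|q⟩ := Σ_S p_S q_S; arXiv text chunk 20)] -/
theorem ip_sum_right {ι : Type*} (s : Finset ι) (u : Finset (Fin n) → ℝ) (v : ι → Finset (Fin n) → ℝ) :
    ip u (∑ i ∈ s, v i) = ∑ i ∈ s, ip u (v i) := by
  rw [ip_comm, ip_sum_left]
  exact sum_congr rfl fun i _ => ip_comm _ _

/-! ### Homogeneous and harmonic coefficient vectors -/

/-- `v` is **homogeneous of degree `t`**: supported on the `t`-element sets (`v ∈ L_t`).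
[cite: LeePrakashDewolfYuen2016, App. B §B.1 (operators W_t, eq. (B.1)–(B.2); arXiv text chunk 19)] -/
def IsHomog (t : ℕ) (v : Finset (Fin n) → ℝ) : Prop := ∀ S, S.card ≠ t → v S = 0

/-- `p` is **harmonic of degree `t`**: homogeneous of degree `t` and killed by the lowering
operator (`p ∈ Ker W_t`).
[cite: LeePrakashDewolfYuen2016, App. B §B.1 (operators W_t, eq. (B.1)–(B.2); arXiv text chunk 19)] -/
def IsHarmonic (t : ℕ) (p : Finset (Fin n) → ℝ) : Prop := IsHomog t p ∧ down p = 0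

/-- `0 ∈ L_t`. [cite: LeePrakashDewolfYuen2016, App. B §B.1 (operators W_t, eq. (B.1)–(B.2); arXiv text chunk 19)] -/
theorem IsHomog.zero (t : ℕ) : IsHomog t (0 : Finset (Fin n) → ℝ) := fun _ _ => rfl

/-- `L_t` is closed under addition. [cite: LeePrakashDewolfYuen2016, App. B §B.1 (operators W_t, eq. (B.1)–(B.2); arXiv text chunk 19)] -/
theorem IsHomog.add {t : ℕ} {u v : Finset (Fin n) → ℝ} (hu : IsHomog t u) (hv : IsHomog t v) :
    IsHomog t (u + v) := fun S hS => by simp [hu S hS, hv S hS]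

/-- `L_t` is closed under scalars. [cite: LeePrakashDewolfYuen2016, App. B §B.1 (operators W_t, eq. (B.1)–(B.2); arXiv text chunk 19)] -/
theorem IsHomog.smul {t : ℕ} {v : Finset (Fin n) → ℝ} (hv : IsHomog t v) (c : ℝ) :
    IsHomog t (c • v) := fun S hS => by simp [hv S hS]

/-- `L_t` is closed under finite sums. [cite: LeePrakashDewolfYuen2016, App. B §B.1 (operators W_t, eq. (B.1)–(B.2); arXiv text chunk 19)] -/
theorem IsHomog.sum {t : ℕ} {ι : Type*} (s : Finset ι) {v : ι → Finset (Fin n) → ℝ}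
    (hv : ∀ i ∈ s, IsHomog t (v i)) : IsHomog t (∑ i ∈ s, v i) := fun S hS => by
  simp only [Finset.sum_apply]
  exact sum_eq_zero fun i hi => hv i hi S hS

/-- `0 ∈ Ker W_t`. [cite: LeePrakashDewolfYuen2016, App. B §B.1 (operators W_t, eq. (B.1)–(B.2); arXiv text chunk 19)] -/
theorem IsHarmonic.zero (t : ℕ) : IsHarmonic t (0 : Finset (Fin n) → ℝ) :=
  ⟨IsHomog.zero t, map_zero _⟩

/-- `Ker W_t` is closed under addition. [cite: LeePrakashDewolfYuen2016, App. B §B.1 (operators W_t, eq. (B.1)–(B.2); arXiv text chunk 19)] -/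
theorem IsHarmonic.add {t : ℕ} {u v : Finset (Fin n) → ℝ} (hu : IsHarmonic t u)
    (hv : IsHarmonic t v) : IsHarmonic t (u + v) :=
  ⟨hu.1.add hv.1, by rw [map_add, hu.2, hv.2, add_zero]⟩

/-- `Ker W_t` is closed under scalars. [cite: LeePrakashDewolfYuen2016, App. B §B.1 (operators W_t, eq. (B.1)–(B.2); arXiv text chunk 19)] -/
theorem IsHarmonic.smul {t : ℕ} {v : Finset (Fin n) → ℝ} (hv : IsHarmonic t v) (c : ℝ) :
    IsHarmonic t (c • v) :=
  ⟨hv.1.smul c, by rw [map_smul, hv.2, smul_zero]⟩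

/-- `Ker W_t` is closed under finite sums. [cite: LeePrakashDewolfYuen2016, App. B §B.1 (operators W_t, eq. (B.1)–(B.2); arXiv text chunk 19)] -/
theorem IsHarmonic.sum {t : ℕ} {ι : Type*} (s : Finset ι) {v : ι → Finset (Fin n) → ℝ}
    (hv : ∀ i ∈ s, IsHarmonic t (v i)) : IsHarmonic t (∑ i ∈ s, v i) :=
  ⟨IsHomog.sum s fun i hi => (hv i hi).1,
    by rw [map_sum]; exact sum_eq_zero fun i hi => (hv i hi).2⟩

/-- Raising maps `L_t` to `L_{t+1}`.
[cite: LeePrakashDewolfYuen2016, App. B §B.1 (operators W_t, eq. (B.1)–(B.2); arXiv text chunk 19)] -/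
theorem isHomog_up {t : ℕ} {v : Finset (Fin n) → ℝ} (hv : IsHomog t v) : IsHomog (t + 1) (up v) := by
  intro S hS
  rw [up_apply]
  refine sum_eq_zero fun i hi => hv _ ?_
  rw [card_erase_of_mem hi]
  have := card_pos.2 ⟨i, hi⟩
  omega

/-- Lowering maps `L_{t+1}` to `L_t`.
[cite: LeePrakashDewolfYuen2016, App. B §B.1 (operators W_t, eq. (B.1)–(B.2); arXiv text chunk 19)] -/
theorem isHomog_down {t : ℕ} {v : Finset (Fin n) → ℝ} (hv : IsHomog (t + 1) v) : IsHomog t (down v) := by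
  intro T hT
  rw [down_apply]
  refine sum_eq_zero fun i hi => hv _ ?_
  rw [mem_compl] at hi
  rw [card_insert_of_notMem hi]
  omega

/-- Iterated raising maps `L_t` to `L_{t+m}`.
[cite: LeePrakashDewolfYuen2016, App. B §B.1 (operators W_t, eq. (B.1)–(B.2); arXiv text chunk 19)] -/
theorem isHomog_iterate_up {t : ℕ} {v : Finset (Fin n) → ℝ} (hv : IsHomog t v) (m : ℕ) :
    IsHomog (t + m) (up^[m] v) := by
  induction m with
  | zero => simpa using hv
  | succ m ih =>
    rw [Function.iterate_succ_apply', ← add_assoc]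
    exact isHomog_up ih

/-- A homogeneous vector of degree `0` is harmonic.
[cite: LeePrakashDewolfYuen2016, App. B Thm. B.5, Cor. B.6 (arXiv text chunk 20)] -/
theorem isHarmonic_of_isHomog_zero {v : Finset (Fin n) → ℝ} (hv : IsHomog 0 v) : IsHarmonic 0 v := by
  refine ⟨hv, ?_⟩
  ext T
  rw [down_apply]
  refine sum_eq_zero fun i hi => hv _ ?_
  rw [mem_compl] at hi
  rw [card_insert_of_notMem hi]
  omega

/-- On a homogeneous vector the support of `v` is where `|T| = t`, so a pointwise factor
depending on `|T|` may be frozen at `t`.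
[cite: LeePrakashDewolfYuen2016, App. B §B.1 (operators W_t, eq. (B.1)–(B.2); arXiv text chunk 19)] -/
theorem IsHomog.mul_card_eq {t : ℕ} {v : Finset (Fin n) → ℝ} (hv : IsHomog t v) (f : ℕ → ℝ)
    (T : Finset (Fin n)) : f T.card * v T = f t * v T := by
  by_cases h : T.card = t
  · rw [h]
  · rw [hv T h, mul_zero, mul_zero]

/-- **Commutation relation on `L_s`**: `W Wᵀ v = Wᵀ W v + (n − 2s) v` for `v ∈ L_s`.
[cite: LeePrakashDewolfYuen2016, App. B Thm. B.1 / Lemma B.8 (Johnson-scheme spectrum; arXiv text chunks 19, 21)] -/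
theorem down_up_of_isHomog {s : ℕ} {v : Finset (Fin n) → ℝ} (hv : IsHomog s v) :
    down (up v) = up (down v) + ((n : ℝ) - 2 * s) • v := by
  ext T
  have h := down_up_sub_up_down v T
  rw [hv.mul_card_eq (fun k => (n : ℝ) - 2 * k)] at h
  simp only [Pi.add_apply, Pi.smul_apply, smul_eq_mul]
  linarith

/-- The ladder eigenvalues `λ_t(m) = (m + 1)(n − 2t − m)`.
[cite: LeePrakashDewolfYuen2016, App. B Thm. B.1 / Lemma B.8 (Johnson-scheme spectrum; arXiv text chunks 19, 21)] -/
def ladder (n t m : ℕ) : ℝ := (m + 1) * ((n : ℝ) - 2 * t - m)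

/-- **Ladder relation**: for a harmonic `p` of degree `t`,
`W (Wᵀ)^{m+1} p = (m+1)(n − 2t − m) · (Wᵀ)^m p`.
[cite: LeePrakashDewolfYuen2016, App. B Thm. B.1 / Lemma B.8 (Johnson-scheme spectrum; arXiv text chunks 19, 21)] -/
theorem down_iterate_up_of_isHarmonic {t : ℕ} {p : Finset (Fin n) → ℝ} (hp : IsHarmonic t p) (m : ℕ) :
    down (up^[m + 1] p) = ladder n t m • up^[m] p := by
  induction m with
  | zero =>
    simp only [zero_add, Function.iterate_one, Function.iterate_zero, id_eq, ladder,
      Nat.cast_zero, sub_zero, one_mul]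
    rw [down_up_of_isHomog hp.1, hp.2, map_zero, zero_add]
  | succ m ih =>
    rw [Function.iterate_succ_apply', down_up_of_isHomog (isHomog_iterate_up hp.1 (m + 1)), ih, map_smul,
      ← Function.iterate_succ_apply' up m p, ← add_smul]
    congr 1
    simp only [ladder, Nat.cast_add, Nat.cast_one]
    ring

/-- **Ladder inner products**: `⟪(Wᵀ)^m v, (Wᵀ)^m q⟫ = (Π_{i<m} λ_t(i)) ⟪v, q⟫` for `q` harmonic of
degree `t` (and any `v`).
[cite: LeePrakashDewolfYuen2016, App. B Lemma B.8 (arXiv text chunk 21)] -/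
theorem ip_iterate_up_of_isHarmonic {t : ℕ} {q : Finset (Fin n) → ℝ} (hq : IsHarmonic t q)
    (v : Finset (Fin n) → ℝ) (m : ℕ) :
    ip (up^[m] v) (up^[m] q) = (∏ i ∈ range m, ladder n t i) * ip v q := by
  induction m with
  | zero => simp
  | succ m ih =>
    rw [Function.iterate_succ_apply', ip_up_left, down_iterate_up_of_isHarmonic hq, ip_smul_right, ih,
      prod_range_succ]
    ring

/-- **Cross terms vanish**: ladders over a lowering-killed `p` and a harmonic `q` of another
length are orthogonal: `⟪(Wᵀ)^m p, (Wᵀ)^{m+d} q⟫ = 0` for `d ≥ 1`.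
[cite: LeePrakashDewolfYuen2016, App. B Lemma B.10 (arXiv text chunk 21)] -/
theorem ip_iterate_up_cross {t : ℕ} {q : Finset (Fin n) → ℝ} (hq : IsHarmonic t q)
    {p : Finset (Fin n) → ℝ} (hp : down p = 0) {d : ℕ} (hd : 1 ≤ d) (m : ℕ) :
    ip (up^[m] p) (up^[m + d] q) = 0 := by
  induction m with
  | zero =>
    obtain ⟨d', rfl⟩ := Nat.exists_eq_add_of_le' hd
    rw [zero_add, Function.iterate_zero, id_eq, Function.iterate_succ_apply', ip_comm, ip_up_left,
      hp, ip_zero_right]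
  | succ m ih =>
    rw [Function.iterate_succ_apply', ip_up_left, show m + 1 + d = (m + d) + 1 by ring,
      down_iterate_up_of_isHarmonic hq, ip_smul_right, ih, mul_zero]


/-! ### Falling factorials over `ℝ` -/

/-- The falling factorial `x(x−1)⋯(x−k+1)` as a real function of `x`.
[cite: Grigoriev2001, §1 (B_k = r(r−1)⋯(r−k+1)/(n(n−1)⋯(n−k+1)), PDF p. 8)] -/
def ff (x : ℝ) (k : ℕ) : ℝ := ∏ j ∈ range k, (x - j)

/-- `ff x 0 = 1`. [cite: Grigoriev2001, §1 (B_k = r(r−1)⋯(r−k+1)/(n(n−1)⋯(n−k+1)), PDF p. 8)] -/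
@[simp] theorem ff_zero (x : ℝ) : ff x 0 = 1 := by simp [ff]

/-- `ff x (k+1) = ff x k · (x − k)`. [cite: Grigoriev2001, §1 (B_k = r(r−1)⋯(r−k+1)/(n(n−1)⋯(n−k+1)), PDF p. 8)] -/
theorem ff_succ (x : ℝ) (k : ℕ) : ff x (k + 1) = ff x k * (x - k) := by
  rw [ff, prod_range_succ, ff]

/-- `ff a k = 0` for naturals `a < k` (the factor `a − a` occurs).
[cite: Grigoriev2001, §1 (B_k = r(r−1)⋯(r−k+1)/(n(n−1)⋯(n−k+1)), PDF p. 8)] -/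
theorem ff_natCast_of_lt {a k : ℕ} (h : a < k) : ff (a : ℝ) k = 0 :=
  prod_eq_zero (mem_range.2 h) (sub_self _)

/-- `ff a k · (a − k)! = a!` for naturals `k ≤ a`.
[cite: Grigoriev2001, §1 (B_k = r(r−1)⋯(r−k+1)/(n(n−1)⋯(n−k+1)), PDF p. 8)] -/
theorem ff_natCast_mul_factorial {a k : ℕ} (h : k ≤ a) :
    ff (a : ℝ) k * ((a - k).factorial : ℝ) = (a.factorial : ℝ) := by
  induction k with
  | zero => simp
  | succ k ih =>
    have hk : k ≤ a := Nat.le_of_succ_le h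
    have hsplit : a - k = (a - (k + 1)) + 1 := by omega
    have hfac : ((a - k).factorial : ℝ) = ((a : ℝ) - k) * ((a - (k + 1)).factorial : ℝ) := by
      rw [hsplit, Nat.factorial_succ, Nat.cast_mul, ← hsplit, Nat.cast_sub hk]
    rw [← ih hk, hfac, ff_succ]
    ring

/-- `ff m m = m!`.
[cite: Grigoriev2001, §1 (B_k = r(r−1)⋯(r−k+1)/(n(n−1)⋯(n−k+1)), PDF p. 8)] -/
theorem ff_self (m : ℕ) : ff (m : ℝ) m = (m.factorial : ℝ) := by
  have := ff_natCast_mul_factorial (le_refl m)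
  simpa using this

/-- A falling factorial of positive factors is positive: `ff x k > 0` if `x > k − 1`.
[cite: Grigoriev2001, §1 (B_k = r(r−1)⋯(r−k+1)/(n(n−1)⋯(n−k+1)), PDF p. 8)] -/
theorem ff_pos {x : ℝ} {k : ℕ} (h : (k : ℝ) - 1 < x) : 0 < ff x k := by
  refine prod_pos fun j hj => ?_
  have : (j : ℝ) ≤ (k : ℝ) - 1 := by
    have := mem_range.1 hj
    have : (j : ℝ) + 1 ≤ k := by exact_mod_cast this
    linarith
  linarith

/-! ### Evaluation on the cube (`zeta`) of raised vectors -/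

/-- Re-indexing pairs `(U ⊆ S, i ∈ U)` by `(T ⊆ S, i ∈ S \ T)` via `T = U \ {i}`.
[cite: LeePrakashDewolfYuen2016, App. B §B.1 (operators W_t, eq. (B.1)–(B.2); arXiv text chunk 19)] -/
theorem sum_powerset_sum_mem_erase (S : Finset (Fin n)) (G : Finset (Fin n) → Fin n → ℝ) :
    ∑ U ∈ S.powerset, ∑ i ∈ U, G (U.erase i) i = ∑ T ∈ S.powerset, ∑ i ∈ S \ T, G T i := by
  rw [sum_sigma', sum_sigma']
  refine sum_nbij' (fun x => ⟨x.1.erase x.2, x.2⟩) (fun y => ⟨insert y.2 y.1, y.2⟩) ?_ ?_ ?_ ?_ ?_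
  · rintro ⟨U, i⟩ hx
    simp only [mem_sigma, mem_powerset] at hx ⊢
    exact ⟨(erase_subset i U).trans hx.1, mem_sdiff.2 ⟨hx.1 hx.2, notMem_erase i U⟩⟩
  · rintro ⟨T, i⟩ hy
    simp only [mem_sigma, mem_powerset, mem_sdiff] at hy ⊢
    exact ⟨insert_subset hy.2.1 hy.1, mem_insert_self i T⟩
  · rintro ⟨U, i⟩ hx
    simp only [mem_sigma, mem_powerset] at hx
    simp [insert_erase hx.2]
  · rintro ⟨T, i⟩ hy
    simp only [mem_sigma, mem_powerset, mem_sdiff] at hy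
    simp [erase_insert hy.2.2]
  · rintro ⟨U, i⟩ _; rfl

/-- `zeta (Wᵀ v)(S) = Σ_{T ⊆ S} |S \ T| · v T`.
[cite: LeePrakashDewolfYuen2016, App. B §B.1 (operators W_t, eq. (B.1)–(B.2); arXiv text chunk 19)] -/
theorem zeta_up (v : Finset (Fin n) → ℝ) (S : Finset (Fin n)) :
    zeta (up v) S = ∑ T ∈ S.powerset, ((S \ T).card : ℝ) * v T := by
  rw [zeta_apply]
  simp only [up_apply]
  rw [sum_powerset_sum_mem_erase S (fun T _ => v T)]
  refine sum_congr rfl fun T _ => ?_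
  rw [sum_const, nsmul_eq_mul]

/-- For `v ∈ L_t`: `zeta (Wᵀ v)(S) = (|S| − t) · zeta v (S)` — raising is multiplication by
`|x| − t` on the cube.
[cite: LeePrakashDewolfYuen2016, App. B §B.1 (operators W_t, eq. (B.1)–(B.2); arXiv text chunk 19)] -/
theorem zeta_up_of_isHomog {t : ℕ} {v : Finset (Fin n) → ℝ} (hv : IsHomog t v) (S : Finset (Fin n)) :
    zeta (up v) S = ((S.card : ℝ) - t) * zeta v S := by
  rw [zeta_up, zeta_apply, mul_sum]
  refine sum_congr rfl fun T hT => ?_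
  rw [mem_powerset] at hT
  rw [card_sdiff_of_subset hT, Nat.cast_sub (card_le_card hT)]
  exact hv.mul_card_eq (fun k => (S.card : ℝ) - k) T

/-- For `v ∈ L_t`: `zeta ((Wᵀ)^m v)(S) = Π_{j<m} (|S| − t − j) · zeta v (S)`.
[cite: LeePrakashDewolfYuen2016, App. B Thm. B.5, Cor. B.6 (arXiv text chunk 20)] -/
theorem zeta_iterate_up_of_isHomog {t : ℕ} {v : Finset (Fin n) → ℝ} (hv : IsHomog t v) (m : ℕ)
    (S : Finset (Fin n)) :
    zeta (up^[m] v) S = (∏ j ∈ range m, ((S.card : ℝ) - t - j)) * zeta v S := by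
  induction m with
  | zero => simp
  | succ m ih =>
    rw [Function.iterate_succ_apply', zeta_up_of_isHomog (isHomog_iterate_up hv m), ih,
      prod_range_succ, Nat.cast_add]
    ring

/-- For `v ∈ L_s` and `|S| = s`: `zeta v (S) = v S`.
[cite: Grigoriev2001, §2 eq. (2.1) (PDF p. 9)] -/
theorem zeta_of_isHomog_of_card_eq {s : ℕ} {v : Finset (Fin n) → ℝ} (hv : IsHomog s v)
    {S : Finset (Fin n)} (hS : S.card = s) : zeta v S = v S := by
  rw [zeta_apply]
  refine sum_eq_single_of_mem S (mem_powerset_self S) fun T hT hTS => hv T ?_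
  rw [mem_powerset] at hT
  have := card_lt_card (hT.ssubset_of_ne hTS)
  omega

/-- For `v ∈ L_t` and `|S| < t`: `zeta v (S) = 0`.
[cite: LeePrakashDewolfYuen2016, App. B Lemma B.8 (arXiv text chunk 21)] -/
theorem zeta_of_isHomog_of_card_lt {t : ℕ} {v : Finset (Fin n) → ℝ} (hv : IsHomog t v)
    {S : Finset (Fin n)} (hS : S.card < t) : zeta v S = 0 := by
  rw [zeta_apply]
  refine sum_eq_zero fun T hT => hv T ?_
  rw [mem_powerset] at hT
  have := card_le_card hT
  omega

/-- For `v ∈ L_t` and `|S| = t + m`: `((Wᵀ)^m v) S = m! · zeta v (S)`, i.e. on the cube the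
`m`-fold raising of `v` is `m!` times `v` itself.
[cite: Grigoriev2001, §2 eq. (2.1) (PDF p. 9)] -/
theorem iterate_up_apply_of_isHomog {t : ℕ} {v : Finset (Fin n) → ℝ} (hv : IsHomog t v) {m : ℕ}
    {S : Finset (Fin n)} (hS : S.card = t + m) :
    (up^[m] v) S = (m.factorial : ℝ) * zeta v S := by
  rw [← zeta_of_isHomog_of_card_eq (isHomog_iterate_up hv m) hS, zeta_iterate_up_of_isHomog hv,
    hS, ← ff_self]
  congr 1
  refine prod_congr rfl fun j _ => ?_
  push_cast
  ring

/-! ### Slice inner products of harmonic components -/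

/-- Slice sums of products of two raised homogeneous vectors are coefficient inner products of
the ladders: `Σ_{|S| = t+m} zeta p (S) zeta q (S) = ⟪(Wᵀ)^m p, (Wᵀ)^{m'} q⟫ / (m! m'!)`.
[cite: LeePrakashDewolfYuen2016, App. B Lemma B.8 (arXiv text chunk 21)] -/
theorem slice_sum_zeta_mul_zeta {t t' m m' : ℕ} {p q : Finset (Fin n) → ℝ} (hp : IsHomog t p)
    (hq : IsHomog t' q) (h : t + m = t' + m') :
    ∑ S ∈ powersetCard (t + m) univ, zeta p S * zeta q S =
      ((m.factorial : ℝ) * m'.factorial)⁻¹ * ip (up^[m] p) (up^[m'] q) := by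
  have hne : ((m.factorial : ℝ) * m'.factorial) ≠ 0 := by positivity
  rw [eq_inv_mul_iff_mul_eq₀ hne, ip, mul_sum]
  symm
  rw [← sum_subset (subset_univ (powersetCard (t + m) univ))]
  · refine sum_congr rfl fun S hS => ?_
    have hS' : S.card = t + m := (mem_powersetCard.1 hS).2
    rw [iterate_up_apply_of_isHomog hp hS', iterate_up_apply_of_isHomog hq (hS'.trans h)]
    ring
  · intro S _ hS
    have hS' : S.card ≠ t + m := fun h' => hS (mem_powersetCard.2 ⟨subset_univ _, h'⟩)
    rw [isHomog_iterate_up hp m S hS', zero_mul]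

/-- `Π_{i<m} (i + 1) = m!` over `ℝ`.
[cite: Grigoriev2001, §1 (B_k = r(r−1)⋯(r−k+1)/(n(n−1)⋯(n−k+1)), PDF p. 8)] -/
theorem prod_range_add_one_cast (m : ℕ) : ∏ i ∈ range m, ((i : ℝ) + 1) = (m.factorial : ℝ) := by
  rw [← prod_range_add_one_eq_factorial, Nat.cast_prod]
  simp

/-- **Same-degree slice inner product** (Johnson scheme): for harmonic `p, q` of degree `t`,
`Σ_{|S| = t+m} zeta p (S) · zeta q (S) = (Π_{i<m} (n − 2t − i) / m!) · ⟪p, q⟫`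
(`= C(n−2t, m) ⟪p, q⟫` when `2t ≤ n`).
[cite: LeePrakashDewolfYuen2016, App. B Lemma B.8 (arXiv text chunk 21)] -/
theorem slice_sum_zeta_mul_zeta_same {t m : ℕ} {p q : Finset (Fin n) → ℝ} (hp : IsHarmonic t p)
    (hq : IsHarmonic t q) :
    ∑ S ∈ powersetCard (t + m) univ, zeta p S * zeta q S =
      (ff ((n : ℝ) - 2 * t) m / m.factorial) * ip p q := by
  rw [slice_sum_zeta_mul_zeta hp.1 hq.1 rfl, ip_iterate_up_of_isHarmonic hq p m]
  have hsplit : ∏ i ∈ range m, ladder n t i = (m.factorial : ℝ) * ff ((n : ℝ) - 2 * t) m := by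
    simp only [ladder]
    rw [prod_mul_distrib, prod_range_add_one_cast, ff]
  rw [hsplit]
  have hne : (m.factorial : ℝ) ≠ 0 := by positivity
  field_simp

/-- **Different degrees are orthogonal on every slice**: for harmonic `p` of degree `t` and `q`
of degree `t' ≠ t`, `Σ_{|S| = s} zeta p (S) · zeta q (S) = 0`.
[cite: LeePrakashDewolfYuen2016, App. B Lemma B.10 (arXiv text chunk 21)] -/
theorem slice_sum_zeta_mul_zeta_cross {t t' s : ℕ} {p q : Finset (Fin n) → ℝ}
    (hp : IsHarmonic t p) (hq : IsHarmonic t' q) (htt : t ≠ t') :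
    ∑ S ∈ powersetCard s univ, zeta p S * zeta q S = 0 := by
  by_cases hst : s < t
  · exact sum_eq_zero fun S hS => by
      rw [zeta_of_isHomog_of_card_lt hp.1 ((mem_powersetCard.1 hS).2 ▸ hst), zero_mul]
  by_cases hst' : s < t'
  · exact sum_eq_zero fun S hS => by
      rw [zeta_of_isHomog_of_card_lt hq.1 ((mem_powersetCard.1 hS).2 ▸ hst'), mul_zero]
  push Not at hst hst'
  obtain ⟨m, rfl⟩ := Nat.exists_eq_add_of_le hst
  obtain ⟨m', hm'⟩ := Nat.exists_eq_add_of_le hst'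
  rw [slice_sum_zeta_mul_zeta hp.1 hq.1 hm']
  rcases lt_or_gt_of_ne htt with hlt | hgt
  · -- `t < t'`, so `m = m' + d` with `d ≥ 1`
    have hd : m = m' + (m - m') := by omega
    rw [hd, ip_comm, ip_iterate_up_cross hp hq.2 (by omega) m', mul_zero]
  · have hd : m' = m + (m' - m) := by omega
    rw [hd, ip_iterate_up_cross hq hp.2 (by omega) m, mul_zero]


/-! ### Linearity of the iterated raising operator -/

/-- Iterates of the raising operator are its powers in `Module.End`. [cite: LeePrakashDewolfYuen2016, App. B §B.1 (operators W_t, eq. (B.1)–(B.2); arXiv text chunk 19)] -/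
theorem iterate_up_eq_pow (k : ℕ) (v : Finset (Fin n) → ℝ) : up^[k] v = (up ^ k) v := by
  rw [Module.End.pow_apply]

/-- `(Wᵀ)^k 0 = 0`. [cite: LeePrakashDewolfYuen2016, App. B §B.1 (operators W_t, eq. (B.1)–(B.2); arXiv text chunk 19)] -/
theorem iterate_up_zero_vec (k : ℕ) : up^[k] (0 : Finset (Fin n) → ℝ) = 0 := by
  rw [iterate_up_eq_pow, map_zero]

/-- `(Wᵀ)^k` is additive. [cite: LeePrakashDewolfYuen2016, App. B §B.1 (operators W_t, eq. (B.1)–(B.2); arXiv text chunk 19)] -/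
theorem iterate_up_add (k : ℕ) (u v : Finset (Fin n) → ℝ) :
    up^[k] (u + v) = up^[k] u + up^[k] v := by
  simp only [iterate_up_eq_pow, map_add]

/-- `(Wᵀ)^k` commutes with scalars. [cite: LeePrakashDewolfYuen2016, App. B §B.1 (operators W_t, eq. (B.1)–(B.2); arXiv text chunk 19)] -/
theorem iterate_up_smul (k : ℕ) (c : ℝ) (v : Finset (Fin n) → ℝ) :
    up^[k] (c • v) = c • up^[k] v := by
  simp only [iterate_up_eq_pow, map_smul]

/-- `(Wᵀ)^k` commutes with finite sums. [cite: LeePrakashDewolfYuen2016, App. B §B.1 (operators W_t, eq. (B.1)–(B.2); arXiv text chunk 19)] -/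
theorem iterate_up_sum (k : ℕ) {ι : Type*} (s : Finset ι) (v : ι → Finset (Fin n) → ℝ) :
    up^[k] (∑ i ∈ s, v i) = ∑ i ∈ s, up^[k] (v i) := by
  simp only [iterate_up_eq_pow, map_sum]

/-! ### The ladder decomposition `L_t = ⊕_{t' ≤ t} (Wᵀ)^{t−t'} Ker W_{t'}` -/

/-- The ladder eigenvalue `λ_{t'}(t − t') = (t − t' + 1)(n − t − t')` is positive as long as
`t + t' < n`; in particular for `t' ≤ t` with `2t < n`.
[cite: LeePrakashDewolfYuen2016, App. B Thm. B.1 / Lemma B.8 (Johnson-scheme spectrum; arXiv text chunks 19, 21)] -/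
theorem ladder_pos {t t' : ℕ} (ht' : t' ≤ t) (ht : 2 * t < n) : 0 < ladder n t' (t - t') := by
  unfold ladder
  have h1 : (0 : ℝ) < (t - t' : ℕ) + 1 := by positivity
  have h2 : (0 : ℝ) < (n : ℝ) - 2 * t' - (t - t' : ℕ) := by
    rw [Nat.cast_sub ht']
    have : ((2 * t + 1 : ℕ) : ℝ) ≤ (n : ℕ) := by exact_mod_cast ht
    push_cast at this
    have ht'' : (t' : ℝ) ≤ t := by exact_mod_cast ht'
    linarith
  exact mul_pos h1 h2

/-- **Ladder decomposition of `L_t`** (`2t ≤ n + 1`): every homogeneous `v` of degree `t` is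
`v = Σ_{t' ≤ t} (Wᵀ)^{t − t'} p_{t'}` with `p_{t'}` harmonic of degree `t'` — the decomposition
`L_t = Ker W_t ⊕ Wᵀ L_{t−1}` iterated, obtained here by inverting `W Wᵀ` on the ladder
components (the ladder eigenvalues are nonzero in this range) instead of by orthogonal projection.
[cite: LeePrakashDewolfYuen2016, App. B Thm. B.5, Cor. B.6 (arXiv text chunk 20)] -/
theorem exists_ladder_decomposition {t : ℕ} (ht : 2 * t ≤ n + 1) {v : Finset (Fin n) → ℝ}
    (hv : IsHomog t v) :
    ∃ p : ℕ → (Finset (Fin n) → ℝ), (∀ t', IsHarmonic t' (p t')) ∧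
      v = ∑ t' ∈ range (t + 1), up^[t - t'] (p t') := by
  induction t generalizing v with
  | zero =>
    refine ⟨fun t' => if t' = 0 then v else 0, fun t' => ?_, by simp⟩
    by_cases h : t' = 0
    · subst h; simpa using isHarmonic_of_isHomog_zero hv
    · simp only [h, if_false]; exact IsHarmonic.zero t'
  | succ t ih =>
    have ht' : 2 * t ≤ n + 1 := by omega
    have hlt : 2 * t < n := by omega
    obtain ⟨p, hp, hdown⟩ := ih ht' (isHomog_down hv)
    -- invert `W Wᵀ` on the ladder components of `W v`
    set g : Finset (Fin n) → ℝ :=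
      ∑ t' ∈ range (t + 1), (ladder n t' (t - t'))⁻¹ • up^[t - t'] (p t') with hg
    have hg_homog : IsHomog t g := by
      refine IsHomog.sum _ fun t' ht'' => IsHomog.smul ?_ _
      have : t' + (t - t') = t := by have := mem_range.1 ht''; omega
      simpa [this] using isHomog_iterate_up (hp t').1 (t - t')
    have hdug : down (up g) = down v := by
      rw [hg, map_sum, map_sum, hdown]
      refine sum_congr rfl fun t' ht'' => ?_
      rw [map_smul, map_smul, ← Function.iterate_succ_apply' up (t - t') (p t'),
        down_iterate_up_of_isHarmonic (hp t'), smul_smul,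
        inv_mul_cancel₀ (ladder_pos (by have := mem_range.1 ht''; omega) hlt).ne', one_smul]
    -- the harmonic top component
    set q : Finset (Fin n) → ℝ := v - up g with hq
    have hq_harm : IsHarmonic (t + 1) q := by
      refine ⟨?_, by rw [hq, map_sub, hdug, sub_self]⟩
      rw [hq, sub_eq_add_neg, ← neg_one_smul ℝ (up g)]
      exact hv.add ((isHomog_up hg_homog).smul _)
    refine ⟨fun t'' => if t'' = t + 1 then q else (ladder n t'' (t - t''))⁻¹ • p t'', fun t'' => ?_, ?_⟩
    · dsimp only
      by_cases h : t'' = t + 1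
      · subst h; simpa using hq_harm
      · simp only [h, if_false]; exact (hp t'').smul _
    · dsimp only
      rw [sum_range_succ, if_pos rfl, Nat.sub_self, Function.iterate_zero, id_eq]
      have hsum : ∑ t'' ∈ range (t + 1),
          up^[t + 1 - t''] (if t'' = t + 1 then q else (ladder n t'' (t - t''))⁻¹ • p t'') = up g := by
        rw [hg, map_sum]
        refine sum_congr rfl fun t'' ht'' => ?_
        have hne : t'' ≠ t + 1 := by have := mem_range.1 ht''; omega
        have hsub : t + 1 - t'' = (t - t'') + 1 := by have := mem_range.1 ht''; omega
        rw [if_neg hne, hsub, Function.iterate_succ_apply', iterate_up_smul, map_smul]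
      rw [hsum, hq, add_sub_cancel]

/-- **Harmonic decomposition of a coefficient vector of degree `≤ l`** (`2l ≤ n + 1`):
`h = Σ_{t ≤ l} Σ_{d ≤ l − t} (Wᵀ)^d p_{t,d}` with `p_{t,d}` harmonic of degree `t`.
[cite: LeePrakashDewolfYuen2016, App. B Thm. B.5, Cor. B.6 (arXiv text chunk 20)] -/
theorem exists_harmonic_decomposition {l : ℕ} (hl : 2 * l ≤ n + 1) {h : Finset (Fin n) → ℝ}
    (hh : ∀ T, l < T.card → h T = 0) :
    ∃ p : ℕ → ℕ → (Finset (Fin n) → ℝ), (∀ t d, IsHarmonic t (p t d)) ∧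
      (∀ t d, l < t + d → p t d = 0) ∧
      h = ∑ t ∈ range (l + 1), ∑ d ∈ range (l + 1), up^[d] (p t d) := by
  induction l generalizing h with
  | zero =>
    have h0 : IsHomog 0 h := fun T hT => hh T (by omega)
    refine ⟨fun t d => if t + d = 0 then h else 0, fun t d => ?_, fun t d htd => ?_, by simp⟩
    · dsimp only
      by_cases htd : t + d = 0
      · rw [if_pos htd]
        have : t = 0 := by omega
        subst this
        exact isHarmonic_of_isHomog_zero h0
      · rw [if_neg htd]; exact IsHarmonic.zero t
    · dsimp only
      rw [if_neg (by omega)]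
  | succ l ih =>
    -- split off the top homogeneous component
    set htop : Finset (Fin n) → ℝ := fun T => if T.card = l + 1 then h T else 0 with htop_def
    have htop_homog : IsHomog (l + 1) htop := fun T hT => by simp [htop_def, hT]
    have hlow : ∀ T, l < T.card → (h - htop) T = 0 := by
      intro T hT
      simp only [Pi.sub_apply, htop_def]
      by_cases hc : T.card = l + 1
      · simp [hc]
      · rw [if_neg hc, sub_zero]; exact hh T (by omega)
    obtain ⟨pl, hpl, hpl0, hsum_low⟩ := ih (by omega) hlow
    obtain ⟨pt, hpt, hsum_top⟩ := exists_ladder_decomposition hl htop_homog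
    refine ⟨fun t d => pl t d + if t + d = l + 1 then pt t else 0, fun t d => ?_, fun t d htd => ?_, ?_⟩
    · dsimp only
      by_cases htd : t + d = l + 1
      · rw [if_pos htd]; exact (hpl t d).add (hpt t)
      · rw [if_neg htd, add_zero]; exact hpl t d
    · dsimp only
      rw [hpl0 t d (by omega), if_neg (by omega), zero_add]
    · dsimp only
      -- the double sum splits into the low part and the ladder of the top part
      have hsplit : ∑ t ∈ range (l + 1 + 1), ∑ d ∈ range (l + 1 + 1),
          up^[d] (pl t d + if t + d = l + 1 then pt t else 0) =
          (∑ t ∈ range (l + 1 + 1), ∑ d ∈ range (l + 1 + 1), up^[d] (pl t d)) +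
          ∑ t ∈ range (l + 1 + 1), ∑ d ∈ range (l + 1 + 1),
            up^[d] (if t + d = l + 1 then pt t else 0) := by
        rw [← sum_add_distrib]
        refine sum_congr rfl fun t _ => ?_
        rw [← sum_add_distrib]
        exact sum_congr rfl fun d _ => iterate_up_add _ _ _
      have hlow_sum : ∑ t ∈ range (l + 1 + 1), ∑ d ∈ range (l + 1 + 1), up^[d] (pl t d) =
          h - htop := by
        rw [hsum_low, sum_range_succ (n := l + 1)]
        have hlast : ∑ d ∈ range (l + 1 + 1), up^[d] (pl (l + 1) d) = 0 :=
          sum_eq_zero fun d _ => by rw [hpl0 (l + 1) d (by omega), iterate_up_zero_vec]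
        rw [hlast, add_zero]
        refine sum_congr rfl fun t _ => ?_
        rw [sum_range_succ (n := l + 1), hpl0 t (l + 1) (by omega), iterate_up_zero_vec, add_zero]
      have htop_sum : ∑ t ∈ range (l + 1 + 1), ∑ d ∈ range (l + 1 + 1),
          up^[d] (if t + d = l + 1 then pt t else 0) = htop := by
        rw [hsum_top]
        refine sum_congr rfl fun t ht => ?_
        have ht' : t ≤ l + 1 := by have := mem_range.1 ht; omega
        rw [sum_eq_single_of_mem (l + 1 - t) (mem_range.2 (by omega))]
        · rw [if_pos (by omega)]
        · intro d _ hd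
          rw [if_neg (by omega), iterate_up_zero_vec]
      rw [hsplit, hlow_sum, htop_sum, sub_add_cancel]

/-- **Evaluation of a harmonic decomposition on the cube**: with `h = Σ_{t,d} (Wᵀ)^d p_{t,d}`,
`zeta h (S) = Σ_{t,d} (|S| − t)(|S| − t − 1)⋯(|S| − t − d + 1) · zeta p_{t,d} (S)`.
[cite: LeePrakashDewolfYuen2016, App. B Thm. B.5, Cor. B.6 (arXiv text chunk 20)] -/
theorem zeta_harmonic_decomposition {l : ℕ} {p : ℕ → ℕ → (Finset (Fin n) → ℝ)}
    (hp : ∀ t d, IsHarmonic t (p t d)) (S : Finset (Fin n)) :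
    zeta (∑ t ∈ range (l + 1), ∑ d ∈ range (l + 1), up^[d] (p t d)) S =
      ∑ t ∈ range (l + 1), ∑ d ∈ range (l + 1), ff ((S.card : ℝ) - t) d * zeta (p t d) S := by
  rw [map_sum, Finset.sum_apply]
  refine sum_congr rfl fun t _ => ?_
  rw [map_sum, Finset.sum_apply]
  refine sum_congr rfl fun d _ => ?_
  rw [zeta_iterate_up_of_isHomog (hp t d).1]
  rfl

/-- The **slice factor** `σ_t(s) = Π_{i < s−t} (n − 2t − i) / (s − t)!` (`= C(n − 2t, s − t)` for
`2t ≤ n`) for `t ≤ s`, and `0` for `s < t`.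
[cite: LeePrakashDewolfYuen2016, App. B Lemma B.8 (arXiv text chunk 21)] -/
def sliceFactor (n t s : ℕ) : ℝ :=
  if t ≤ s then ff ((n : ℝ) - 2 * t) (s - t) / (s - t).factorial else 0

/-- Slice inner products of two members of harmonic families, in terms of `sliceFactor`.
[cite: LeePrakashDewolfYuen2016, App. B Lemma B.8 (arXiv text chunk 21)] -/
theorem slice_sum_zeta_mul_zeta_eq {t t' s : ℕ} {p q : Finset (Fin n) → ℝ} (hp : IsHarmonic t p)
    (hq : IsHarmonic t' q) :
    ∑ S ∈ powersetCard s univ, zeta p S * zeta q S =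
      if t = t' then sliceFactor n t s * ip p q else 0 := by
  by_cases htt : t = t'
  · subst htt
    rw [if_pos rfl, sliceFactor]
    by_cases hts : t ≤ s
    · obtain ⟨m, rfl⟩ := Nat.exists_eq_add_of_le hts
      rw [if_pos hts, slice_sum_zeta_mul_zeta_same hp hq, Nat.add_sub_cancel_left]
    · rw [if_neg hts, zero_mul]
      exact sum_eq_zero fun S hS => by
        rw [zeta_of_isHomog_of_card_lt hp.1 ((mem_powersetCard.1 hS).2 ▸ (by omega)), zero_mul]
  · rw [if_neg htt]
    exact slice_sum_zeta_mul_zeta_cross hp hq htt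

/-- **Parseval on a slice**: for `h = Σ_{t,d} (Wᵀ)^d p_{t,d}` (harmonic decomposition),
`Σ_{|S| = s} zeta h (S)² = Σ_t σ_t(s) · Σ_{d,d'} ff(s−t, d) ff(s−t, d') ⟪p_{t,d}, p_{t,d'}⟫`.
[cite: LeePrakashDewolfYuen2016, App. B Thm. B.11 (arXiv text chunk 21)] -/
theorem slice_sum_zeta_sq {l : ℕ} {p : ℕ → ℕ → (Finset (Fin n) → ℝ)}
    (hp : ∀ t d, IsHarmonic t (p t d)) (s : ℕ) :
    ∑ S ∈ powersetCard s univ,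
        (zeta (∑ t ∈ range (l + 1), ∑ d ∈ range (l + 1), up^[d] (p t d)) S) ^ 2 =
      ∑ t ∈ range (l + 1), sliceFactor n t s *
        ∑ d ∈ range (l + 1), ∑ d' ∈ range (l + 1),
          ff ((s : ℝ) - t) d * ff ((s : ℝ) - t) d' * ip (p t d) (p t d') := by
  -- expand the square of the double sum and integrate over the slice termwise
  have hexp : ∀ S ∈ powersetCard s univ,
      (zeta (∑ t ∈ range (l + 1), ∑ d ∈ range (l + 1), up^[d] (p t d)) S) ^ 2 =
        ∑ t ∈ range (l + 1), ∑ d ∈ range (l + 1), ∑ t' ∈ range (l + 1), ∑ d' ∈ range (l + 1),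
          ff ((s : ℝ) - t) d * ff ((s : ℝ) - t') d' * (zeta (p t d) S * zeta (p t' d') S) := by
    intro S hS
    have hS' : (S.card : ℝ) = s := by rw [(mem_powersetCard.1 hS).2]
    rw [zeta_harmonic_decomposition hp, hS', sq, sum_mul]
    refine sum_congr rfl fun t _ => ?_
    rw [sum_mul]
    refine sum_congr rfl fun d _ => ?_
    rw [mul_sum]
    refine sum_congr rfl fun t' _ => ?_
    rw [mul_sum]
    refine sum_congr rfl fun d' _ => ?_
    ring
  rw [sum_congr rfl hexp, sum_comm]
  refine sum_congr rfl fun t ht => ?_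
  rw [sum_comm, mul_sum]
  refine sum_congr rfl fun d _ => ?_
  rw [sum_comm]
  -- collapse the `t'` sum onto the diagonal `t' = t`
  rw [mul_sum]
  have hinner : ∀ t' ∈ range (l + 1), ∑ S ∈ powersetCard s univ, ∑ d' ∈ range (l + 1),
      ff ((s : ℝ) - t) d * ff ((s : ℝ) - t') d' * (zeta (p t d) S * zeta (p t' d') S) =
      if t = t' then ∑ d' ∈ range (l + 1),
        sliceFactor n t s * (ff ((s : ℝ) - t) d * ff ((s : ℝ) - t) d' * ip (p t d) (p t d')) else 0 := by
    intro t' _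
    rw [sum_comm]
    by_cases htt : t = t'
    · subst htt
      rw [if_pos rfl]
      refine sum_congr rfl fun d' _ => ?_
      rw [← mul_sum, slice_sum_zeta_mul_zeta_eq (hp t d) (hp t d'), if_pos rfl]
      ring
    · rw [if_neg htt]
      refine sum_eq_zero fun d' _ => ?_
      rw [← mul_sum, slice_sum_zeta_mul_zeta_eq (hp t d) (hp t' d'), if_neg htt, mul_zero]
  rw [sum_congr rfl hinner, sum_ite_eq, if_pos ht]

end JohnsonHarmonics

end Literature.Combinatorics.AssociationSchemes

end
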